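import Literature.MathematicalPhysics.KineticTheory.Hilbert6Wave0
import HarnessLib

/-!
# Hilbert's sixth problem (family `hilbert6`), wave 0: classification of collision invariants

Trunk: T-KINETIC; family `hilbert6`. Discharge of the named fact
`Literature.MathematicalPhysics.KineticTheory.IsCollisionInvariant.exists_eq_quadratic` (**hilbert6.S09**, classification of
continuous collision invariants) stated in
`Literature/MathematicalPhysics/KineticTheory/Hilbert6Wave0.lean`:

* `IsCollisionInvariant.exists_eq_quadratic_holds : IsCollisionInvariant.exists_eq_quadratic` —
  in velocity dimension `d ≥ 2`, a *continuous* collision invariant `φ` (i.e.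
  `φ(v') + φ(v_*') = φ(v) + φ(v_*)` for all velocity pairs and impact directions) is of the form
  `φ(v) = a + ⟪b, v⟫ + c ‖v‖²` (Cercignani–Illner–Pulvirenti, *The Mathematical Theory of Dilute
  Gases* (1994), §3.1, Thm. 3.1.1, pp. 37–40, with Problems 2–6 and 10 of §3.1, p. 40; the result
  goes back to Boltzmann, Gronwall, Carleman and Grad, the printed continuous-case argument to
  Arkeryd–Cercignani).

The proof follows the architecture printed in CIP 1994, pp. 37–40, on a general real inner
product space `E` with `2 ≤ finrank ℝ E` in place of `ℝ³`:

1. (`IsCollisionInvariant.apply_add_add_apply_zero`; CIP §3.1 Problems 4 and 10) for a collision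
   invariant `φ` the function `f = φ - φ 0` is *orthogonally additive*:
   `f (u + v) = f u + f v` whenever `⟪u, v⟫ = 0` — the collision with impact direction
   `ω = v / ‖v‖` maps the pair `(u, v)` to `(u + v, 0)`.
2. (`orthAdd_even_radial`, `orthAdd_even_eq_mul_norm_sq`; CIP (1.23)–(1.26)) the even part
   `k u = f u + f (-u)` is radial, `x ↦ k (√x • e)` is additive on `[0, ∞)`, and Cauchy's theorem
   for continuous additive functions (Mathlib's `map_real_smul`, applied to the odd extension)
   gives `k u = C ‖u‖²`.
3. (`orthAdd_odd_line`, `orthAdd_odd_additive`, `orthAdd_odd_eq_inner`; CIP (1.27)–(1.31)) the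
   odd part `h u = f u - f (-u)` is additive along every line (orthogonal additivity inside a
   two-dimensional coordinate plane plus oddness), hence additive, hence — being continuous — a
   continuous linear functional, which Riesz representation (`InnerProductSpace.toDual`) writes
   as `⟪B, ·⟫`.
4. `φ = φ 0 + (k + h) / 2`.

No new definitions are introduced (this file is a pure proof file).

Also discharged here (section `GainLoss`, appended): the gain/loss splitting
`collisionOp_eq_gain_sub_loss_holds : collisionOp_eq_gain_sub_loss` (**hilbert6.S09**;
CIP 1994 §2.2 (2.2.2) with (2.2.12)–(2.2.13), p. 23, and §3.1, remark after (3.1.11), p. 35):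
`Q(f, g)(v) = Q⁺(f, g)(v) - Q⁻(f, g)(v)` whenever the gain and loss integrands are integrable over
`E × S^{d-1}` at `v` — linearity of the Bochner integral, the inner `ω`-integral being split for
a.e. `v_*` by Fubini (`MeasureTheory.Integrable.prod_right_ae`).
-/

open scoped InnerProductSpace

namespace Literature.MathematicalPhysics.KineticTheory

variable {E : Type*} [NormedAddCommGroup E] [InnerProductSpace ℝ E]

/-! ### Step 1: collision invariants are orthogonally additive up to the constant `φ 0` -/

/-- For a collision invariant `φ` and orthogonal velocities `u ⊥ v` one has
`φ (u + v) + φ 0 = φ u + φ v`, i.e. `φ - φ 0` is additive on orthogonal pairs: the elastic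
collision with impact direction `ω = v / ‖v‖` sends `(u, v)` to `(u + v, 0)`
(CIP 1994 §3.1, Problems 4 and 10, p. 40). [cite: CIP1994, §3.1 Problems 4 and 10, p. 40] -/
theorem IsCollisionInvariant.apply_add_add_apply_zero {φ : E → ℝ} (hφ : IsCollisionInvariant φ)
    {u v : E} (huv : ⟪u, v⟫_ℝ = 0) : φ (u + v) + φ 0 = φ u + φ v := by
  by_cases hv : v = 0
  · subst hv
    simp
  have hn : ‖v‖ ≠ 0 := norm_ne_zero_iff.mpr hv
  obtain ⟨ω, hω⟩ : ∃ ω : Metric.sphere (0 : E) 1, (ω : E) = ‖v‖⁻¹ • v :=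
    ⟨⟨‖v‖⁻¹ • v, by
      rw [mem_sphere_zero_iff_norm, norm_smul, norm_inv, norm_norm, inv_mul_cancel₀ hn]⟩, rfl⟩
  have hinner : ⟪u - v, ‖v‖⁻¹ • v⟫_ℝ = -‖v‖ := by
    rw [real_inner_smul_right, inner_sub_left, huv, real_inner_self_eq_norm_sq, zero_sub, mul_neg, sq,
      ← mul_assoc, inv_mul_cancel₀ hn, one_mul]
  have hs : (-‖v‖) • (‖v‖⁻¹ • v) = -v := by
    rw [smul_smul, neg_mul, mul_inv_cancel₀ hn, neg_one_smul]
  have key := hφ ω (u, v)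
  simp only [collide, hω, hinner, hs, sub_neg_eq_add, add_neg_cancel] at key
  linarith

/-! ### Orthonormal pairs in dimension `≥ 2` -/

/-- A real inner product space of dimension at least `2` contains an orthonormal pair.
[folklore] -/
theorem exists_orthonormal_pair (hE : 2 ≤ Module.finrank ℝ E) :
    ∃ e₁ e₂ : E, ‖e₁‖ = 1 ∧ ‖e₂‖ = 1 ∧ ⟪e₁, e₂⟫_ℝ = 0 := by
  haveI : FiniteDimensional ℝ E := Module.finite_of_finrank_pos (by omega)
  let b := stdOrthonormalBasis ℝ E
  refine ⟨b ⟨0, by omega⟩, b ⟨1, by omega⟩, b.norm_eq_one _, b.norm_eq_one _,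
    b.inner_eq_zero ?_⟩
  intro h
  exact absurd (congrArg Fin.val h) (by norm_num)

/-- In a real inner product space of dimension at least `2`, every vector admits a unit vector
orthogonal to it. [folklore] -/
theorem exists_norm_eq_one_and_inner_eq_zero (hE : 2 ≤ Module.finrank ℝ E) (e : E) :
    ∃ w : E, ‖w‖ = 1 ∧ ⟪e, w⟫_ℝ = 0 := by
  obtain ⟨e₁, e₂, he₁, he₂, he₁₂⟩ := exists_orthonormal_pair hE
  obtain ⟨u₀, hu₀⟩ : ∃ u₀ : E, u₀ = ⟪e, e₂⟫_ℝ • e₁ - ⟪e, e₁⟫_ℝ • e₂ := ⟨_, rfl⟩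
  have horth : ⟪e, u₀⟫_ℝ = 0 := by
    rw [hu₀, inner_sub_right, real_inner_smul_right, real_inner_smul_right]
    ring
  by_cases h0 : u₀ = 0
  · refine ⟨e₁, he₁, ?_⟩
    have h1 : ⟪u₀, e₂⟫_ℝ = -⟪e, e₁⟫_ℝ := by
      rw [hu₀, inner_sub_left, real_inner_smul_left, real_inner_smul_left, he₁₂,
        real_inner_self_eq_norm_sq, he₂]
      ring
    rw [h0, inner_zero_left] at h1
    linarith
  · refine ⟨‖u₀‖⁻¹ • u₀, ?_, ?_⟩
    · rw [norm_smul, norm_inv, norm_norm, inv_mul_cancel₀ (norm_ne_zero_iff.mpr h0)]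
    · rw [real_inner_smul_right, horth, mul_zero]

/-! ### Step 2: the even part (CIP 1994 (1.23)–(1.26)) -/

/-- An even orthogonally additive function is radial: `‖p‖ = ‖q‖ → k p = k q`
(CIP 1994 (1.23)–(1.24), p. 38–39: `p + q ⊥ p - q`). [cite: CIP1994, §3.1 (1.23)–(1.24), pp. 38–39] -/
theorem orthAdd_even_radial {k : E → ℝ}
    (hk : ∀ u v : E, ⟪u, v⟫_ℝ = 0 → k (u + v) = k u + k v) (heven : ∀ u, k (-u) = k u)
    {p q : E} (hpq : ‖p‖ = ‖q‖) : k p = k q := by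
  have key : ∀ a b : E, ‖a‖ = ‖b‖ → k ((2 : ℝ) • a) = k (a + b) + k (a - b) := by
    intro a b hab
    have h1 : ⟪a + b, a - b⟫_ℝ = 0 := by
      rw [inner_add_left, inner_sub_right, inner_sub_right, real_inner_self_eq_norm_sq,
        real_inner_self_eq_norm_sq, hab, real_inner_comm a b]
      ring
    rw [← hk (a + b) (a - b) h1, two_smul]
    congr 1
    abel
  have half : ∀ x : E, (2 : ℝ) • ((1 / 2 : ℝ) • x) = x := fun x => by
    rw [smul_smul]; norm_num
  have hpq' : ‖(1 / 2 : ℝ) • p‖ = ‖(1 / 2 : ℝ) • q‖ := by rw [norm_smul, norm_smul, hpq]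
  have h1 := key _ _ hpq'
  have h2 := key _ _ hpq'.symm
  rw [half] at h1 h2
  rw [h1, h2, add_comm ((1 / 2 : ℝ) • q) ((1 / 2 : ℝ) • p), ← heven ((1 / 2 : ℝ) • q - (1 / 2 : ℝ) • p),
    neg_sub]

/-- **Even part of CIP 1994 Thm. 3.1.1** (Carleman's argument, CIP (1.23)–(1.26), pp. 38–39). In
dimension `≥ 2`, a continuous, even, orthogonally additive real function `k` is `k u = C ‖u‖²`:
`k` is radial, `x ↦ k (√x • e)` is additive on `[0, ∞)`, and Cauchy's theorem for continuous
additive functions applies. [cite: CIP1994, Thm. 3.1.1, (1.23)–(1.26), pp. 38–39] -/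
theorem orthAdd_even_eq_mul_norm_sq (hE : 2 ≤ Module.finrank ℝ E) {k : E → ℝ}
    (hk : ∀ u v : E, ⟪u, v⟫_ℝ = 0 → k (u + v) = k u + k v) (heven : ∀ u, k (-u) = k u)
    (hcont : Continuous k) : ∃ C : ℝ, ∀ u, k u = C * ‖u‖ ^ 2 := by
  obtain ⟨e₁, e₂, he₁, he₂, he₁₂⟩ := exists_orthonormal_pair hE
  have hrad : ∀ p q : E, ‖p‖ = ‖q‖ → k p = k q := fun p q => orthAdd_even_radial hk heven
  have hk0 : k 0 = 0 := by
    have := hk 0 0 (inner_zero_left _)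
    rw [add_zero] at this
    linarith
  -- `K x = k (√x • e₁)`: vanishes on `(-∞, 0]`, additive on `[0, ∞)` (CIP (1.25)).
  obtain ⟨K, hK⟩ : ∃ K : ℝ → ℝ, ∀ x, K x = k (Real.sqrt x • e₁) := ⟨_, fun _ => rfl⟩
  have hKneg : ∀ x, x ≤ 0 → K x = 0 := by
    intro x hx
    rw [hK, Real.sqrt_eq_zero'.mpr hx, zero_smul, hk0]
  have hKadd : ∀ x y, 0 ≤ x → 0 ≤ y → K (x + y) = K x + K y := by
    intro x y hx hy
    have horth : ⟪Real.sqrt x • e₁, Real.sqrt y • e₂⟫_ℝ = 0 := by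
      rw [real_inner_smul_left, real_inner_smul_right, he₁₂, mul_zero, mul_zero]
    have n1 : ‖Real.sqrt x • e₁ + Real.sqrt y • e₂‖ = ‖Real.sqrt (x + y) • e₁‖ := by
      have sq : ‖Real.sqrt x • e₁ + Real.sqrt y • e₂‖ ^ 2 = ‖Real.sqrt (x + y) • e₁‖ ^ 2 := by
        rw [norm_add_sq_real, horth, norm_smul, norm_smul, norm_smul, he₁, he₂,
          Real.norm_of_nonneg (Real.sqrt_nonneg _), Real.norm_of_nonneg (Real.sqrt_nonneg _),
          Real.norm_of_nonneg (Real.sqrt_nonneg _), mul_one, mul_one, mul_one,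
          Real.sq_sqrt hx, Real.sq_sqrt hy, Real.sq_sqrt (add_nonneg hx hy)]
        ring
      exact (sq_eq_sq₀ (norm_nonneg _) (norm_nonneg _)).mp sq
    have n2 : ‖Real.sqrt y • e₂‖ = ‖Real.sqrt y • e₁‖ := by
      rw [norm_smul, norm_smul, he₁, he₂]
    rw [hK, hK, hK, ← hrad _ _ n1, hk _ _ horth, hrad _ _ n2]
  have hKcont : Continuous K := by
    rw [show K = fun x => k (Real.sqrt x • e₁) from funext hK]
    exact hcont.comp (Real.continuous_sqrt.smul continuous_const)
  -- odd extension `L x = K x - K (-x)`: continuous and additive on all of `ℝ`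
  obtain ⟨L, hL⟩ : ∃ L : ℝ → ℝ, ∀ x, L x = K x - K (-x) := ⟨_, fun _ => rfl⟩
  have hmixed : ∀ x y, 0 ≤ x → y ≤ 0 → L (x + y) = L x + L y := by
    intro x y hx hy
    rw [hL, hL, hL, hKneg y hy, hKneg (-x) (by linarith)]
    rcases le_total 0 (x + y) with hxy | hxy
    · rw [hKneg (-(x + y)) (by linarith)]
      have := hKadd (x + y) (-y) hxy (by linarith)
      rw [show x + y + -y = x by ring] at this
      linarith
    · rw [hKneg (x + y) hxy]
      have := hKadd (-(x + y)) x (by linarith) hx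
      rw [show -(x + y) + x = -y by ring] at this
      linarith
  have hLadd : ∀ x y, L (x + y) = L x + L y := by
    intro x y
    rcases le_total 0 x with hx | hx <;> rcases le_total 0 y with hy | hy
    · rw [hL, hL, hL, hKadd x y hx hy, hKneg (-x) (by linarith), hKneg (-y) (by linarith),
        hKneg (-(x + y)) (by linarith)]
      ring
    · exact hmixed x y hx hy
    · rw [add_comm x y, hmixed y x hy hx, add_comm]
    · rw [hL, hL, hL, hKneg x hx, hKneg y hy, hKneg (x + y) (by linarith), neg_add,
        hKadd (-x) (-y) (by linarith) (by linarith)]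
      ring
  have hLcont : Continuous L := by
    rw [show L = fun x => K x - K (-x) from funext hL]
    exact hKcont.sub (hKcont.comp continuous_neg)
  -- Cauchy's theorem for continuous additive real functions (CIP (1.26))
  have hLlin : ∀ x, L x = x * L 1 := by
    intro x
    have hc : Continuous (AddMonoidHom.mk' L hLadd) := hLcont
    have := map_real_smul (AddMonoidHom.mk' L hLadd) hc x 1
    simpa using this
  refine ⟨K 1, fun u => ?_⟩
  have h1 : k u = K (‖u‖ ^ 2) := by
    rw [hK, Real.sqrt_sq (norm_nonneg u)]
    apply hrad
    rw [norm_smul, he₁, Real.norm_of_nonneg (norm_nonneg u), mul_one]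
  have h2 : K (‖u‖ ^ 2) = L (‖u‖ ^ 2) := by
    rw [hL, hKneg (-(‖u‖ ^ 2)) (neg_nonpos.mpr (by positivity)), sub_zero]
  have h3 : L 1 = K 1 := by
    rw [hL, hKneg (-1) (by norm_num), sub_zero]
  rw [h1, h2, hLlin, h3, mul_comm]

/-! ### Step 3: the odd part (CIP 1994 (1.27)–(1.31)) -/

/-- **Odd part of CIP 1994 Thm. 3.1.1, additivity along lines** (CIP (1.27)–(1.29), p. 39). In
dimension `≥ 2`, an odd orthogonally additive function `h` satisfies
`h ((s + t) • e) = h (s • e) + h (t • e)`: expand `h (U + V)` for the orthogonal pair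
`U = s • e + w`, `V = t • e - (s t ‖e‖²) • w` (`w` a unit vector orthogonal to `e`) by orthogonal
additivity, do the same for `(-s, -t)`, and subtract using oddness. [cite: CIP1994, Thm. 3.1.1, (1.27)–(1.29), p. 39] -/
theorem orthAdd_odd_line (hE : 2 ≤ Module.finrank ℝ E) {h : E → ℝ}
    (hh : ∀ u v : E, ⟪u, v⟫_ℝ = 0 → h (u + v) = h u + h v) (hodd : ∀ u, h (-u) = -h u)
    (e : E) (s t : ℝ) : h ((s + t) • e) = h (s • e) + h (t • e) := by
  obtain ⟨w, hw, hew⟩ := exists_norm_eq_one_and_inner_eq_zero hE e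
  have hwe : ⟪w, e⟫_ℝ = 0 := by rw [real_inner_comm]; exact hew
  have aux : ∀ s t : ℝ, h ((s + t) • e) + h ((1 - s * t * ‖e‖ ^ 2) • w) =
      h (s • e) + h w + (h (t • e) + h ((-(s * t * ‖e‖ ^ 2)) • w)) := by
    intro s t
    have hU : ⟪s • e, w⟫_ℝ = 0 := by rw [real_inner_smul_left, hew, mul_zero]
    have hV : ⟪t • e, (-(s * t * ‖e‖ ^ 2)) • w⟫_ℝ = 0 := by
      rw [real_inner_smul_left, real_inner_smul_right, hew, mul_zero, mul_zero]
    have hUV : ⟪s • e + w, t • e + (-(s * t * ‖e‖ ^ 2)) • w⟫_ℝ = 0 := by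
      simp only [inner_add_left, inner_add_right, real_inner_smul_left, real_inner_smul_right,
        hew, hwe, real_inner_self_eq_norm_sq, hw]
      ring
    have hsum : ⟪(s + t) • e, (1 - s * t * ‖e‖ ^ 2) • w⟫_ℝ = 0 := by
      rw [real_inner_smul_left, real_inner_smul_right, hew, mul_zero, mul_zero]
    have e1 := hh _ _ hUV
    rw [hh _ _ hU, hh _ _ hV] at e1
    rw [← hh _ _ hsum, ← e1]
    congr 1
    simp only [add_smul, sub_smul, one_smul, neg_smul]
    abel
  have h1 := aux s t
  have h2 := aux (-s) (-t)
  rw [show -s + -t = -(s + t) by ring, show -s * -t = s * t by ring, neg_smul, neg_smul, neg_smul,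
    hodd, hodd, hodd] at h2
  linarith

/-- **Odd part of CIP 1994 Thm. 3.1.1, additivity** (CIP (1.27)–(1.30), p. 39). In dimension
`≥ 2`, an odd orthogonally additive function is additive: decompose `v` into its components along
`u` and orthogonal to `u` and combine orthogonal additivity with `orthAdd_odd_line`.
[cite: CIP1994, Thm. 3.1.1, (1.27)–(1.30), p. 39] -/
theorem orthAdd_odd_additive (hE : 2 ≤ Module.finrank ℝ E) {h : E → ℝ}
    (hh : ∀ u v : E, ⟪u, v⟫_ℝ = 0 → h (u + v) = h u + h v) (hodd : ∀ u, h (-u) = -h u)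
    (u v : E) : h (u + v) = h u + h v := by
  have h0 : h 0 = 0 := by
    have := hodd 0
    rw [neg_zero] at this
    linarith
  by_cases hu : u = 0
  · rw [hu, zero_add, h0, zero_add]
  have hun : ‖u‖ ^ 2 ≠ 0 := pow_ne_zero 2 (norm_ne_zero_iff.mpr hu)
  obtain ⟨r, hr⟩ : ∃ r : ℝ, r = ⟪u, v⟫_ℝ / ‖u‖ ^ 2 := ⟨_, rfl⟩
  have hperp : ⟪u, v - r • u⟫_ℝ = 0 := by
    rw [inner_sub_right, real_inner_smul_right, real_inner_self_eq_norm_sq, hr,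
      div_mul_cancel₀ _ hun, sub_self]
  have e1 : u + v = (1 + r) • u + (v - r • u) := by
    rw [add_smul, one_smul]
    abel
  have hp1 : ⟪(1 + r) • u, v - r • u⟫_ℝ = 0 := by rw [real_inner_smul_left, hperp, mul_zero]
  have hp2 : ⟪r • u, v - r • u⟫_ℝ = 0 := by rw [real_inner_smul_left, hperp, mul_zero]
  have e2 : h v = h (r • u) + h (v - r • u) := by
    rw [← hh _ _ hp2]
    congr 1
    abel
  rw [e1, hh _ _ hp1, orthAdd_odd_line hE hh hodd u 1 r, one_smul, e2]
  ring

/-- **Odd part of CIP 1994 Thm. 3.1.1** (CIP (1.27)–(1.31), p. 39). In dimension `≥ 2`, a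
continuous, odd, orthogonally additive real function is a continuous linear functional, hence of
the form `h u = ⟪B, u⟫` (Cauchy's theorem for continuous additive maps, `map_real_smul`, and Riesz
representation on the finite-dimensional space `E`). [cite: CIP1994, Thm. 3.1.1, (1.27)–(1.31), p. 39] -/
theorem orthAdd_odd_eq_inner (hE : 2 ≤ Module.finrank ℝ E) {h : E → ℝ}
    (hh : ∀ u v : E, ⟪u, v⟫_ℝ = 0 → h (u + v) = h u + h v) (hodd : ∀ u, h (-u) = -h u)
    (hcont : Continuous h) : ∃ B : E, ∀ u, h u = ⟪B, u⟫_ℝ := by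
  haveI : FiniteDimensional ℝ E := Module.finite_of_finrank_pos (by omega)
  haveI : CompleteSpace E := FiniteDimensional.complete ℝ E
  have hc : Continuous (AddMonoidHom.mk' h (orthAdd_odd_additive hE hh hodd)) := hcont
  refine ⟨(InnerProductSpace.toDual ℝ E).symm
    ((AddMonoidHom.mk' h (orthAdd_odd_additive hE hh hodd)).toRealLinearMap hc), fun u => ?_⟩
  rw [InnerProductSpace.toDual_symm_apply]
  rfl

/-! ### Step 4: assembly -/

/-- **hilbert6.S09, discharged** (classification of continuous collision invariants;
Cercignani–Illner–Pulvirenti, *The Mathematical Theory of Dilute Gases* (1994), §3.1,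
Thm. 3.1.1, pp. 37–40, with Problems 2–6 and 10, p. 40; Boltzmann, Gronwall, Carleman, Grad). In
velocity dimension `d ≥ 2`, every continuous collision invariant is of the form
`φ(v) = a + ⟪b, v⟫ + c ‖v‖²`. Proof: `f = φ - φ 0` is orthogonally additive
(`IsCollisionInvariant.apply_add_add_apply_zero`); its even part is `C ‖v‖²`
(`orthAdd_even_eq_mul_norm_sq`) and its odd part is `⟪B, v⟫` (`orthAdd_odd_eq_inner`), so
`φ v = φ 0 + ⟪B/2, v⟫ + (C/2) ‖v‖²`. [cite: CIP1994, Thm. 3.1.1, pp. 37–40] -/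
theorem IsCollisionInvariant.exists_eq_quadratic_holds :
    IsCollisionInvariant.exists_eq_quadratic (E := E) := by
  intro hE φ hφ hcont
  obtain ⟨f, hf⟩ : ∃ f : E → ℝ, ∀ u, f u = φ u - φ 0 := ⟨_, fun _ => rfl⟩
  have hfc : Continuous f := by
    rw [show f = fun u => φ u - φ 0 from funext hf]
    exact hcont.sub continuous_const
  have hfadd : ∀ u v : E, ⟪u, v⟫_ℝ = 0 → f (u + v) = f u + f v := by
    intro u v huv
    rw [hf, hf, hf]
    have := hφ.apply_add_add_apply_zero huv
    linarith
  have hfneg : ∀ u v : E, ⟪u, v⟫_ℝ = 0 → f (-(u + v)) = f (-u) + f (-v) := by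
    intro u v huv
    rw [neg_add]
    exact hfadd _ _ (by rw [inner_neg_neg, huv])
  obtain ⟨C, hC⟩ := orthAdd_even_eq_mul_norm_sq hE (k := fun u => f u + f (-u))
    (fun u v huv => by
      show f (u + v) + f (-(u + v)) = f u + f (-u) + (f v + f (-v))
      rw [hfadd u v huv, hfneg u v huv]; ring)
    (fun u => by show f (-u) + f (- -u) = f u + f (-u); rw [neg_neg, add_comm]) (by fun_prop)
  obtain ⟨B, hB⟩ := orthAdd_odd_eq_inner hE (h := fun u => f u - f (-u))
    (fun u v huv => by
      show f (u + v) - f (-(u + v)) = f u - f (-u) + (f v - f (-v))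
      rw [hfadd u v huv, hfneg u v huv]; ring)
    (fun u => by show f (-u) - f (- -u) = -(f u - f (-u)); rw [neg_neg, neg_sub]) (by fun_prop)
  refine ⟨φ 0, C / 2, (1 / 2 : ℝ) • B, fun v => ?_⟩
  have h1 := hC v
  have h2 := hB v
  simp only [hf] at h1 h2
  rw [real_inner_smul_left]
  linarith

/-! ### Gain/loss splitting of the hard-sphere collision operator (CIP 1994 §2.2, §3.1) -/

section GainLoss

open _root_.MeasureTheory _root_.Metric

variable [FiniteDimensional ℝ E] [MeasurableSpace E] [BorelSpace E]

/-- Gain/loss splitting `Q = Q⁺ - Q⁻` (`hilbert6.S09`), discharge of the named fact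
`collisionOp_eq_gain_sub_loss`; CIP 1994 §2.2 (2.2.2) "`= G - L`" with the gain and loss terms
(2.2.12)–(2.2.13), p. 23, and §3.1, the remark after (3.1.11), p. 35: "the integral … can be split
into the difference of two integrals (one containing `f'f_*'`, the other `f f_*`)". If the gain
and the loss integrands are integrable over `E × S^{d-1}` at `v`, then
`Q(f, g)(v) = Q⁺(f, g)(v) - Q⁻(f, g)(v)`. Proof: by Fubini (`Integrable.prod_right_ae`) both
`ω`-integrands are integrable for a.e. `v_*`, so the inner integral splits a.e.; the outer one
splits by `Integrable.integral_prod_left`. [cite: CIPDiluteGases1994, §3.1 (3.1.11) p. 35 and §2.2 (2.2.2), (2.2.12)–(2.2.13) p. 23] -/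
theorem collisionOp_eq_gain_sub_loss_holds : collisionOp_eq_gain_sub_loss (E := E) := by
  intro f g v hgain hloss
  haveI : IsFiniteMeasure (sphereMeasure : Measure (sphere (0 : E) 1)) := by
    unfold sphereMeasure; infer_instance
  -- the two slice families are integrable in `ω` for a.e. `v_*`
  have h1 : ∀ᵐ w ∂(volume : Measure E), Integrable (fun ω : sphere (0 : E) 1 =>
      hardSphereKernel (v, w) ω * (f (collide ω (v, w)).1 * g (collide ω (v, w)).2))
      sphereMeasure :=
    hgain.prod_right_ae
  have h2 : ∀ᵐ w ∂(volume : Measure E), Integrable (fun ω : sphere (0 : E) 1 =>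
      hardSphereKernel (v, w) ω * (f v * g w)) sphereMeasure :=
    hloss.prod_right_ae
  -- hence the inner integral splits for a.e. `v_*`
  have hpt : (fun w => ∫ ω, collisionIntegrand f g (v, w) ω ∂sphereMeasure) =ᵐ[volume]
      fun w => (∫ ω, hardSphereKernel (v, w) ω * (f (collide ω (v, w)).1 * g (collide ω (v, w)).2)
        ∂sphereMeasure) - ∫ ω, hardSphereKernel (v, w) ω * (f v * g w) ∂sphereMeasure := by
    filter_upwards [h1, h2] with w hw1 hw2
    rw [← integral_sub hw1 hw2]
    refine integral_congr_ae (ae_of_all _ fun ω => ?_)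
    simp only [collisionIntegrand, mul_sub]
  -- and the outer integrals of the two inner integrals are finite
  have hA : Integrable (fun w => ∫ ω, hardSphereKernel (v, w) ω *
      (f (collide ω (v, w)).1 * g (collide ω (v, w)).2) ∂sphereMeasure) (volume : Measure E) :=
    hgain.integral_prod_left
  have hB : Integrable (fun w => ∫ ω, hardSphereKernel (v, w) ω * (f v * g w) ∂sphereMeasure)
      (volume : Measure E) :=
    hloss.integral_prod_left
  unfold collisionOp collisionGain collisionLoss
  rw [integral_congr_ae hpt]
  exact integral_sub hA hB

end GainLoss

end Literature.MathematicalPhysics.KineticTheory
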